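import Summits.CriticalPhenomena.Ising3DConformalLimit.Theorems.EnergyNotSigmaSquaredGapForcesFarMergingScreeningDefs
import Literature.Probability.LatticeModels.IsingLaceThrough
import Literature.Probability.LatticeModels.IsingTransport
import Mathlib.MeasureTheory.Integral.Bochner.SumMeasure
import HarnessLib

/-!
# The screening dictionary (ADC21 Lemma A.1 at the full radius, read on the box trace laws)
(line `screening-form-lemma-a1` of crux `GapForcesFarMerging`, item stmt-CriticalPhenomena-4468;
stub `stub_screeningIdentity`)

For `o, x, a, b ∈ Λ_n = box 3 n`, `meanScreening n n o x a b = 1 - P^{{o}∆{x},{a}∆{b}}_{Λ_n,β_c}[o ↔ a]`: the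
mean screening `𝔼^{ox,∅}_{Λ_n}[𝟙[a,b ∉ C(o)] ⟨σ_aσ_b⟩_{Λ_n∖C(o)}/⟨σ_aσ_b⟩_{Λ_n}]` of the probe pair by the full
duplicated cluster `C(o) = C_{n₁+n₂}(o)` IS the two-current avoidance probability. Route (tree theorems only):
the box trace law is the push-forward of the explicit sum of Dirac masses `doubleCurrentMeasure (freeBoxGraph 3 n)`,
so integrals against it are series over pairs of currents (`integral_sourcedDoubleCurrentLaw`); on the lifted
trace the cluster of `o` is the current cluster `(p.1+p.2).cluster o` (`liftBonds_mem_openConn_iff`) and the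
depleted two-point function `⟨σ_aσ_b⟩_{Λ_n∖C}` is that of `offGraph (freeBoxGraph 3 n) C` (transport
`isingTwoPoint_free_map`, `IsingLace.isingTwoPoint_compl_eq_offGraph_univ`, random currents), so the screening
ratio is `Current.offRatio · Z[∅]/Z[ab]`; then ADC21 Lemma A.1 (`Current.tsum_epairWeight_eq_tsum_mul_offRatio`)
with `F = 𝟙[a ∉ C]𝟙[b ∉ C]`, and under `∂n₂ = {a}∆{b}` the events `{b ∈ C(o)}`, `{a ∈ C(o)}` coincide.
Reference: Aizenman–Duminil-Copin, Ann. of Math. 194 (2021) = arXiv:1912.07973, Appendix A, Lemma A.1; §3.1.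
-/

noncomputable section

namespace Summit.CriticalPhenomena.Ising3DConformalLimit.EnergyNotSigmaSquaredGapForcesFarMerging

open scoped symmDiff ENNReal
open MeasureTheory Filter Finset
open Literature.Probability.LatticeModels Literature.Probability.Percolation
open Summit.CriticalPhenomena.Ising3DConformalLimit.GapForcesFarMergingScreening

/-! ### Finite graphs: the `ℝ≥0∞` dictionary for the double-current measure -/

section FiniteGraph

variable {V : Type*} [Fintype V] [DecidableEq V] (G : SimpleGraph V) [DecidableRel G.Adj]

/-- The tree's real pair weight, cast to `ℝ≥0∞`, is the `ℝ≥0∞` pair weight of the constant coupling.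
[folklore] -/
theorem ofReal_pairWeight_eq_epairWeight {β : ℝ} (hβ : 0 ≤ β) (A B : Finset V)
    (p : Current G × Current G) :
    ENNReal.ofReal (pairWeight G β A B p) = epairWeight (fun _ : G.edgeFinset => β) A B p := by
  unfold pairWeight epairWeight Current.eweight
  split_ifs with h
  · rw [ENNReal.ofReal_mul (Current.weight_nonneg hβ _)]
    rfl
  · exact ENNReal.ofReal_zero

/-- The normalised pair weight `w_{A,B}(p)/(Z[A]Z[B])` read in `ℝ≥0∞` (`β ≥ 0`, nondegenerate normalisers).
[folklore] -/
theorem ofReal_pairWeight_div {β : ℝ} (hβ : 0 ≤ β) {A B : Finset V} (hA : currentSum G β A ≠ 0)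
    (hB : currentSum G β B ≠ 0) (p : Current G × Current G) :
    ENNReal.ofReal (pairWeight G β A B p / (currentSum G β A * currentSum G β B)) =
      epairWeight (fun _ : G.edgeFinset => β) A B p /
        (ecurrentSum (fun _ : G.edgeFinset => β) A * ecurrentSum (fun _ : G.edgeFinset => β) B) := by
  have hK : ∀ e : G.edgeFinset, 0 ≤ (fun _ : G.edgeFinset => β) e := fun _ => hβ
  have hZ : 0 < currentSum G β A * currentSum G β B :=
    mul_pos (lt_of_le_of_ne (currentSum_nonneg G hβ A) (Ne.symm hA))
      (lt_of_le_of_ne (currentSum_nonneg G hβ B) (Ne.symm hB))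
  rw [ENNReal.ofReal_div_of_pos hZ, ENNReal.ofReal_mul (currentSum_nonneg G hβ A),
    ofReal_pairWeight_eq_epairWeight G hβ, currentSum_eq_wcurrentSum, currentSum_eq_wcurrentSum,
    ← ecurrentSum_eq_ofReal hK, ← ecurrentSum_eq_ofReal hK]

/-- The same in real form: `w_{A,B}(p)/(Z[A]Z[B])` is the real part of the `ℝ≥0∞` ratio. [folklore] -/
theorem pairWeight_div_eq_toReal {β : ℝ} (hβ : 0 ≤ β) {A B : Finset V} (hA : currentSum G β A ≠ 0)
    (hB : currentSum G β B ≠ 0) (p : Current G × Current G) :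
    pairWeight G β A B p / (currentSum G β A * currentSum G β B) =
      (epairWeight (fun _ : G.edgeFinset => β) A B p /
        (ecurrentSum (fun _ : G.edgeFinset => β) A * ecurrentSum (fun _ : G.edgeFinset => β) B)).toReal := by
  rw [← ofReal_pairWeight_div G hβ hA hB, ENNReal.toReal_ofReal (div_nonneg (pairWeight_nonneg G hβ A B p)
    (mul_nonneg (currentSum_nonneg G hβ A) (currentSum_nonneg G hβ B)))]

/-- The double-current measure of an event as an `ℝ≥0∞` series:
`P^{A,B}[E] = (∑_p 1{∂n₁=A}1{∂n₂=B} w w 𝟙_E) / (Z[A] Z[B])` (`β ≥ 0`, nondegenerate normalisers).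
[cite: AizenmanDuminilCopinAnnals2021, §3.1] -/
theorem doubleCurrentMeasure_apply_eq_tsum_div {β : ℝ} (hβ : 0 ≤ β) {A B : Finset V}
    (hA : currentSum G β A ≠ 0) (hB : currentSum G β B ≠ 0) (E : Set (Current G × Current G)) :
    doubleCurrentMeasure G β A B E =
      (∑' p, epairWeight (fun _ : G.edgeFinset => β) A B p * E.indicator 1 p) /
        (ecurrentSum (fun _ : G.edgeFinset => β) A * ecurrentSum (fun _ : G.edgeFinset => β) B) := by
  have hE : MeasurableSet E := E.to_countable.measurableSet
  rw [doubleCurrentMeasure, Measure.sum_apply _ hE, div_eq_mul_inv, ← ENNReal.tsum_mul_right]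
  refine tsum_congr fun p => ?_
  rw [Measure.smul_apply, smul_eq_mul, Measure.dirac_apply' _ hE, ofReal_pairWeight_div G hβ hA hB,
    div_eq_mul_inv]
  ring

/-- The current sums of the off-graph `G ∖ T` are the real parts of the tree's supported `ℝ≥0∞` sums
`ecurrentSumIn (offGraph G T)` (`β ≥ 0`). [folklore] -/
theorem currentSum_offGraph_eq_toReal {β : ℝ} (hβ : 0 ≤ β) (T B : Finset V) :
    currentSum (offGraph G T) β B =
      (ecurrentSumIn (offGraph G T) (fun _ : G.edgeFinset => β) B).toReal := by
  rw [IsingLace.currentSum_offGraph, ecurrentSumIn,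
    ENNReal.tsum_toReal_eq fun n => by split_ifs <;> simp]
  refine tsum_congr fun n => ?_
  split_ifs
  · rw [Current.eweight, ← Current.weight_eq_wweight, ENNReal.toReal_ofReal (Current.weight_nonneg hβ n)]
  · rfl

variable {G} in
/-- Pair weights are finite. [folklore] -/
theorem epairWeight_ne_top (K : G.edgeFinset → ℝ) (A B : Finset V) (p : Current G × Current G) :
    epairWeight K A B p ≠ ∞ := by
  unfold epairWeight
  split_ifs
  · exact ENNReal.mul_ne_top (Current.eweight_ne_top K _) (Current.eweight_ne_top K _)
  · exact ENNReal.zero_ne_top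

variable {G} in
/-- The restricted correlation `Z_{G∖T}[B]/Z_{G∖T}[∅]` is finite (`K ≥ 0`). [folklore] -/
theorem offRatio_ne_top {K : G.edgeFinset → ℝ} (hK : ∀ e, 0 ≤ K e) (T B : Finset V) :
    Current.offRatio K T B ≠ ∞ :=
  ENNReal.div_ne_top (ecurrentSumIn_ne_top _ hK _)
    (lt_of_lt_of_le zero_lt_one (one_le_ecurrentSumIn_empty (offGraph G T) K)).ne'

variable {G} in
/-- Under `∂n₂ = {a}∆{b}` the second current joins `a` to `b`, so on `{∂n₁ = A, ∂n₂ = {a}∆{b}}` the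
indicator of `{o ↮ a}` is `𝟙[a ∉ C(o)] = 𝟙[a ∉ C(o)]𝟙[b ∉ C(o)]`, `C(o) = C_{n₁+n₂}(o)`.
[cite: AizenmanDuminilCopinAnnals2021, Appendix A, Lemma A.1] -/
theorem epairWeight_mul_indicator_not_conn (K : G.edgeFinset → ℝ) (A : Finset V) (o a b : V)
    (p : Current G × Current G) :
    epairWeight K A ({a} ∆ {b}) p * (tracedConn G o a)ᶜ.indicator 1 p =
      epairWeight K A ({a} ∆ {b}) p *
        (if a ∈ (p.1 + p.2).cluster o ∨ b ∈ (p.1 + p.2).cluster o then 0 else 1) := by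
  by_cases hs : p.1.sources = A ∧ p.2.sources = {a} ∆ {b}
  · have hab : b ∈ (p.1 + p.2).cluster a := Current.mem_cluster_add_of_sources_eq_right p.1 hs.2
    have hiff : (a ∈ (p.1 + p.2).cluster o ∨ b ∈ (p.1 + p.2).cluster o) ↔ a ∈ (p.1 + p.2).cluster o :=
      ⟨fun h => h.elim id fun hb => Current.mem_cluster_trans hb (Current.mem_cluster_comm.1 hab), Or.inl⟩
    have hmem : p ∈ (tracedConn G o a)ᶜ ↔ a ∉ (p.1 + p.2).cluster o := by
      rw [Set.mem_compl_iff, mem_tracedConn_iff, Current.mem_cluster_iff]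
    congr 1
    by_cases ha : a ∈ (p.1 + p.2).cluster o
    · rw [Set.indicator_of_notMem (fun h => hmem.1 h ha), if_pos (Or.inl ha)]
    · rw [Set.indicator_of_mem (hmem.2 ha), if_neg (fun h => ha (hiff.1 h)), Pi.one_apply]
  · rw [epairWeight, if_neg hs, zero_mul, zero_mul]

/-- `ℝ≥0∞` bookkeeping: `e/(Z_A Z_0) · (f r Z_0 / Z_B) = e (f r)/(Z_A Z_B)` for finite nonzero `Z`'s. [folklore] -/
theorem div_mul_mul_div_rearrange {e f r zA zB z0 : ℝ≥0∞} (hA : zA ≠ ∞) (hB : zB ≠ ∞) (h0 : z0 ≠ 0)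
    (h0' : z0 ≠ ∞) : e / (zA * z0) * (f * r * z0 / zB) = e * (f * r) / (zA * zB) := by
  rw [div_eq_mul_inv, div_eq_mul_inv, div_eq_mul_inv, ENNReal.mul_inv (Or.inr h0') (Or.inl hA),
    ENNReal.mul_inv (Or.inr hB) (Or.inl hA)]
  calc e * (zA⁻¹ * z0⁻¹) * (f * r * z0 * zB⁻¹)
      = e * (f * r) * (zA⁻¹ * zB⁻¹) * (z0⁻¹ * z0) := by ring
    _ = e * (f * r) * (zA⁻¹ * zB⁻¹) := by rw [ENNReal.inv_mul_cancel h0 h0', mul_one]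

end FiniteGraph

/-! ### The box trace laws: integrals, clusters and the depleted two-point function -/

section Box

/-- **Integrals against the box trace law are series over pairs of currents**:
`∫ f dP^{A,B}_{Λ_L,β} = ∑_p w_{A,B}(p)/(Z[A]Z[B]) · f(trace p)` for every `f` (the law is a countable sum
of Dirac masses pushed forward under the lifted trace; `β ≥ 0`). [cite: AizenmanDuminilCopinAnnals2021, §3.1] -/
theorem integral_sourcedDoubleCurrentLaw {d : ℕ} (L : ℕ) {β : ℝ} (hβ : 0 ≤ β) (A B : Finset (Site d))
    (f : BondConfig (Site d) → ℝ) :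
    ∫ ω, f ω ∂(sourcedDoubleCurrentLaw d L β A B) =
      ∑' p : Current (freeBoxGraph d L) × Current (freeBoxGraph d L),
        pairWeight (freeBoxGraph d L) β (boxSources d L A) (boxSources d L B) p /
            (currentSum (freeBoxGraph d L) β (boxSources d L A) * currentSum (freeBoxGraph d L) β (boxSources d L B)) *
          f (sourcedTrace d L p) := by
  have hmeas := measurable_sourcedTrace (d := d) L
  rw [sourcedDoubleCurrentLaw, doubleCurrentMeasure, Measure.map_sum hmeas.aemeasurable]
  simp only [Measure.map_smul, Measure.map_dirac' hmeas]
  rw [integral_sum_dirac fun _ => ENNReal.ofReal_ne_top]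
  refine tsum_congr fun p => ?_
  rw [smul_eq_mul, ENNReal.toReal_ofReal]
  exact div_nonneg (pairWeight_nonneg _ hβ _ _ p) (mul_nonneg (currentSum_nonneg _ hβ _) (currentSum_nonneg _ hβ _))

/-- Every open bond of the lifted trace joins two nearest neighbours of `Λ_L`: the open graph of the
trace is a graph of steps inside the box. [folklore] -/
theorem openGraph_sourcedTrace_le {d : ℕ} (L : ℕ) (p : Current (freeBoxGraph d L) × Current (freeBoxGraph d L)) :
    openGraph (sourcedTrace d L p) ≤ withinGraph (zdGraph d) (↑(box d L) : Set (Site d)) := by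
  intro u v huv
  rw [openGraph_adj] at huv
  obtain ⟨⟨e, he, heq⟩, -⟩ := huv
  have he' : e ∈ (freeBoxGraph d L).edgeFinset := he.1
  clear he
  induction e using Sym2.ind with
  | _ a b =>
    have hab := (freeBoxGraph_adj d a b).1 (SimpleGraph.mem_edgeFinset.1 he')
    rw [Sym2.map_mk, Sym2.eq_iff] at heq
    rw [withinGraph_adj, Finset.mem_coe, Finset.mem_coe]
    rcases heq with ⟨rfl, rfl⟩ | ⟨rfl, rfl⟩
    · exact ⟨hab.1, hab.2.1, hab.2.2⟩
    · exact ⟨hab.1.symm, hab.2.2, hab.2.1⟩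

/-- **The cluster of `o` on the lifted trace is the current cluster**: for box vertices `o, z`,
`↑z ∈ C_{trace p}(↑o) ↔ z ∈ C_{p.1+p.2}(o)` (`liftBonds_mem_openConn_iff`). [folklore] -/
theorem coe_mem_openCluster_sourcedTrace_iff {d : ℕ} (L : ℕ) (p : Current (freeBoxGraph d L) × Current (freeBoxGraph d L))
    (o z : BoxVertex d L) :
    (z : Site d) ∈ openCluster (sourcedTrace d L p) (o : Site d) ↔ z ∈ (p.1 + p.2).cluster o := by
  rw [Current.mem_cluster_iff]
  exact liftBonds_mem_openConn_iff d _ o z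

/-- **The explored cluster at the full radius is the current cluster**: for `o ∈ Λ_n`, the cluster of
`o` explored inside `Λ_n` on the lifted trace of `p` is the image in `ℤ³` of `C_{p.1+p.2}(o)` (every
lifted bond has both endpoints in `Λ_n`). [cite: AizenmanDuminilCopinAnnals2021, §6.2] -/
theorem innerCluster_sourcedTrace (n : ℕ) (p : Current (freeBoxGraph 3 n) × Current (freeBoxGraph 3 n))
    {o : BoxVertex 3 n} (ho : (o : Site 3) ∈ box 3 n) :
    innerCluster n o (sourcedTrace 3 n p) = ((p.1 + p.2).cluster o).map (boxEmb 3 n) := by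
  ext v
  simp only [innerCluster, Finset.mem_filter, Finset.mem_map, boxEmb_apply]
  constructor
  · rintro ⟨hv, hcl⟩
    refine ⟨⟨v, box_subset_box_succ 3 n hv⟩, ?_, rfl⟩
    exact (coe_mem_openCluster_sourcedTrace_iff n p o ⟨v, _⟩).1 (openClusterIn_subset_openCluster _ _ _ hcl)
  · rintro ⟨w, hw, rfl⟩
    have hmem : (w : Site 3) ∈
        openClusterIn (withinGraph (zdGraph 3) (↑(box 3 n) : Set (Site 3))) (sourcedTrace 3 n p) o := by
      rw [mem_openClusterIn_iff, inf_eq_left.2 (openGraph_sourcedTrace_le n p)]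
      exact (coe_mem_openCluster_sourcedTrace_iff n p o w).2 hw
    exact ⟨Finset.mem_coe.1 (openClusterIn_withinGraph_subset (Finset.mem_coe.2 ho) _ hmem), hmem⟩

/-- **The screening ratio of a set of box vertices is the restricted correlation of the off-graph**:
for `a, b ∈ Λ_n ∖ C`, `S⁽ⁿ⁾_{ab}(C) = (Z_{G∖C}[ab]/Z_{G∖C}[∅]) · Z[∅]/Z[ab]` on `G = freeBoxGraph 3 n`
at `β_c` (transport of the depleted free state of `Λ_n ∖ C` to the box graph, Sakai's off-graph reading of
the restricted state, and the random-current representation). [cite: AizenmanDuminilCopinAnnals2021, Appendix A, Lemma A.1] -/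
theorem screening_map_cluster (n : ℕ) (C : Finset (BoxVertex 3 n)) {a b : BoxVertex 3 n}
    (ha : (a : Site 3) ∈ box 3 n) (hb : (b : Site 3) ∈ box 3 n) (haC : a ∉ C) (hbC : b ∉ C) :
    screening n (C.map (boxEmb 3 n)) a b =
      (Current.offRatio (fun _ : (freeBoxGraph 3 n).edgeFinset => criticalBeta 3) C ({a} ∆ {b}) *
        ecurrentSum (fun _ : (freeBoxGraph 3 n).edgeFinset => criticalBeta 3) ∅ /
        ecurrentSum (fun _ : (freeBoxGraph 3 n).edgeFinset => criticalBeta 3) ({a} ∆ {b})).toReal := by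
  have hβ : 0 ≤ criticalBeta 3 := criticalBeta_nonneg 3
  have hK : ∀ e : (freeBoxGraph 3 n).edgeFinset, 0 ≤ (fun _ : (freeBoxGraph 3 n).edgeFinset => criticalBeta 3) e :=
    fun _ => hβ
  unfold screening boxTwoPoint
  -- the full box
  rw [Finset.sdiff_empty, isingTwoPoint_free_box_eq_boxGraph 3 n _ a b ha hb,
    isingTwoPoint_free_eq_currentSum_div_holds (freeBoxGraph 3 n) (criticalBeta 3) a b]
  -- the depleted box, transported to the box graph
  have hT : box 3 n \ C.map (boxEmb 3 n) = (boxCore 3 n \ C).map (boxEmb 3 n) := by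
    rw [Finset.map_sdiff, map_boxCore]
  have hadj : ∀ x ∈ boxCore 3 n \ C, ∀ y ∈ boxCore 3 n \ C,
      ((zdGraph 3).Adj (boxEmb 3 n x) (boxEmb 3 n y) ↔ (freeBoxGraph 3 n).Adj x y) := by
    intro x hx y hy
    rw [freeBoxGraph_adj, boxEmb_apply, boxEmb_apply]
    exact ⟨fun h => ⟨h, (mem_boxCore 3).1 (mem_sdiff.1 hx).1, (mem_boxCore 3).1 (mem_sdiff.1 hy).1⟩, fun h => h.1⟩
  rw [hT, show (a : Site 3) = boxEmb 3 n a from rfl, show (b : Site 3) = boxEmb 3 n b from rfl,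
    isingTwoPoint_free_map (boxEmb 3 n) hadj (criticalBeta 3) 0 a b]
  -- from the volume `Λ_n ∖ C` to `Cᶜ` (the extra vertices are isolated), then to the off-graph
  have h12 : boxCore 3 n \ C ⊆ Cᶜ := fun v hv => Finset.mem_compl.2 (Finset.mem_sdiff.1 hv).2
  have hE : edgesIn (freeBoxGraph 3 n) Cᶜ ⊆ edgesIn (freeBoxGraph 3 n) (boxCore 3 n \ C) := by
    intro e he
    rw [mem_edgesIn_iff] at he ⊢
    have hin : e ∈ edgesIn (freeBoxGraph 3 n) (boxCore 3 n) := by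
      rw [edgesIn_freeBoxGraph, edgesTouching_freeBoxGraph]; exact SimpleGraph.mem_edgeFinset.2 he.1
    exact ⟨he.1, fun v hv => mem_sdiff.2 ⟨(mem_edgesIn_iff.1 hin).2 v hv, mem_compl.1 (he.2 v hv)⟩⟩
  have hAB : ({a} ∆ {b} : Finset (BoxVertex 3 n)) ⊆ boxCore 3 n \ C := by
    intro v hv
    rcases Finset.mem_symmDiff.1 hv with ⟨hv, -⟩ | ⟨hv, -⟩ <;> rw [Finset.mem_singleton.1 hv] <;>
      simp [mem_boxCore, ha, hb, haC, hbC]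
  have hcorr : isingTwoPoint (freeBoxGraph 3 n) (boxCore 3 n \ C) (criticalBeta 3) 0 .free a b =
      isingTwoPoint (freeBoxGraph 3 n) Cᶜ (criticalBeta 3) 0 .free a b := by
    have h := isingCorr_free_eq_of_edgesIn_subset (freeBoxGraph 3 n) h12 hE (criticalBeta 3) 0 hAB
    simpa only [isingTwoPoint, isingCorr, spinPair_eq_spinProduct_symmDiff] using h.symm
  rw [hcorr, IsingLace.isingTwoPoint_compl_eq_offGraph_univ (criticalBeta 3) haC hbC,
    isingTwoPoint_free_eq_currentSum_div_holds (offGraph (freeBoxGraph 3 n) C) (criticalBeta 3) a b,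
    currentSum_offGraph_eq_toReal _ hβ, currentSum_offGraph_eq_toReal _ hβ, currentSum_eq_wcurrentSum,
    currentSum_eq_wcurrentSum, ← toReal_ecurrentSum hK, ← toReal_ecurrentSum hK, Current.offRatio,
    ENNReal.toReal_div, ENNReal.toReal_mul, ENNReal.toReal_div, div_div_eq_mul_div]

/-- **The screening functional on the lifted trace of a pair of currents** (full radius, `o, a, b ∈ Λ_n`):
`screenWeight n n o a b (trace p) = 𝟙[a,b ∉ C] · (Z_{G∖C}[ab]/Z_{G∖C}[∅]) · Z[∅]/Z[ab]`, `C = C_{p.1+p.2}(o)`.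
[cite: AizenmanDuminilCopinAnnals2021, Appendix A, Lemma A.1] -/
theorem screenWeight_sourcedTrace (n : ℕ) {o a b : BoxVertex 3 n} (ho : (o : Site 3) ∈ box 3 n)
    (ha : (a : Site 3) ∈ box 3 n) (hb : (b : Site 3) ∈ box 3 n)
    (p : Current (freeBoxGraph 3 n) × Current (freeBoxGraph 3 n)) :
    screenWeight n n o a b (sourcedTrace 3 n p) =
      ((if a ∈ (p.1 + p.2).cluster o ∨ b ∈ (p.1 + p.2).cluster o then (0 : ℝ≥0∞) else 1) *
            Current.offRatio (fun _ : (freeBoxGraph 3 n).edgeFinset => criticalBeta 3) ((p.1 + p.2).cluster o)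
              ({a} ∆ {b}) * ecurrentSum (fun _ : (freeBoxGraph 3 n).edgeFinset => criticalBeta 3) ∅ /
        ecurrentSum (fun _ : (freeBoxGraph 3 n).edgeFinset => criticalBeta 3) ({a} ∆ {b})).toReal := by
  unfold screenWeight
  by_cases h : a ∈ (p.1 + p.2).cluster o ∨ b ∈ (p.1 + p.2).cluster o
  · rw [if_pos (by rwa [coe_mem_openCluster_sourcedTrace_iff, coe_mem_openCluster_sourcedTrace_iff]),
      if_pos h, zero_mul, zero_mul, ENNReal.zero_div, ENNReal.toReal_zero]
  · rw [if_neg (by rwa [coe_mem_openCluster_sourcedTrace_iff, coe_mem_openCluster_sourcedTrace_iff]),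
      if_neg h, one_mul, innerCluster_sourcedTrace n p ho]
    push Not at h
    exact screening_map_cluster n _ ha hb h.1 h.2

/-- A pair of points of a set spans a symmetric difference inside it. [folklore] -/
theorem symmDiff_pair_subset {s : Finset (Site 3)} {u v : Site 3} (hu : u ∈ s) (hv : v ∈ s) :
    ({u} ∆ {v} : Finset (Site 3)) ⊆ s := by
  intro z hz
  rcases Finset.mem_symmDiff.1 hz with ⟨hz, -⟩ | ⟨hz, -⟩ <;> rw [Finset.mem_singleton.1 hz] <;> assumption

/-- `Z[{u}∆{v}] ≠ 0` on the free box graph at `β_c(3) > 0` for `u, v ∈ Λ_n` (a current with these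
sources exists, `currentSum_boxSources_pos`). [folklore] -/
theorem currentSum_pair_ne_zero (n : ℕ) {u v : BoxVertex 3 n} (hu : (u : Site 3) ∈ box 3 n)
    (hv : (v : Site 3) ∈ box 3 n) : currentSum (freeBoxGraph 3 n) (criticalBeta 3) ({u} ∆ {v}) ≠ 0 := by
  rw [← boxSources_pair]
  exact (currentSum_boxSources_pos 3 (criticalBeta_pos_holds (d := 3) (by norm_num))
    (symmDiff_pair_subset hu hv) (even_card_singleton_symmDiff _ _)).ne'

/-- **The screening dictionary on box vertices** (ADC21 Lemma A.1 at the full radius): for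
`o, x, a, b ∈ Λ_n`, `meanScreening n n o x a b = 1 - P^{{o}∆{x},{a}∆{b}}_{Λ_n,β_c}[o ↔ a]`.
[cite: AizenmanDuminilCopinAnnals2021, Appendix A, Lemma A.1] -/
theorem meanScreening_eq_one_sub (n : ℕ) (o x a b : BoxVertex 3 n) (ho : (o : Site 3) ∈ box 3 n)
    (hx : (x : Site 3) ∈ box 3 n) (ha : (a : Site 3) ∈ box 3 n) (hb : (b : Site 3) ∈ box 3 n) :
    meanScreening n n o x a b =
      1 - (sourcedDoubleCurrentLaw 3 n (criticalBeta 3) ({(o : Site 3)} ∆ {(x : Site 3)})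
        ({(a : Site 3)} ∆ {(b : Site 3)})).real (openConn (o : Site 3) (a : Site 3)) := by
  -- nondegeneracy of the normalisers
  have hβ : 0 ≤ criticalBeta 3 := criticalBeta_nonneg 3
  have hK : ∀ e : (freeBoxGraph 3 n).edgeFinset, 0 ≤ (fun _ : (freeBoxGraph 3 n).edgeFinset => criticalBeta 3) e :=
    fun _ => hβ
  have hsA : boxSources 3 n (({(o : Site 3)} : Finset (Site 3)) ∆ {(x : Site 3)}) = {o} ∆ {x} :=
    boxSources_pair 3 n o x
  have hsB : boxSources 3 n (({(a : Site 3)} : Finset (Site 3)) ∆ {(b : Site 3)}) = {a} ∆ {b} :=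
    boxSources_pair 3 n a b
  have hs0 : boxSources 3 n (∅ : Finset (Site 3)) = ∅ := boxSources_empty n
  have hcA := currentSum_pair_ne_zero n ho hx
  have hcB := currentSum_pair_ne_zero n ha hb
  have hc0 : currentSum (freeBoxGraph 3 n) (criticalBeta 3) ∅ ≠ 0 := (currentSum_empty_pos' _ _).ne'
  have hZtop : ∀ S : Finset (BoxVertex 3 n), ecurrentSum (fun _ : (freeBoxGraph 3 n).edgeFinset => criticalBeta 3) S ≠ ∞ :=
    fun S => ecurrentSum_ne_top hK S
  have hZne : ∀ S : Finset (BoxVertex 3 n), currentSum (freeBoxGraph 3 n) (criticalBeta 3) S ≠ 0 →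
      ecurrentSum (fun _ : (freeBoxGraph 3 n).edgeFinset => criticalBeta 3) S ≠ 0 := fun S hS h =>
    hS (by rw [currentSum_eq_wcurrentSum, ← toReal_ecurrentSum hK, h, ENNReal.toReal_zero])
  -- the functional `F = 𝟙[a ∉ C(o)] 𝟙[b ∉ C(o)]` of Lemma A.1: local and vanishing
  obtain ⟨F, hF⟩ : ∃ F : Current (freeBoxGraph 3 n) × Current (freeBoxGraph 3 n) → ℝ≥0∞,
      ∀ p, F p = if a ∈ (p.1 + p.2).cluster o ∨ b ∈ (p.1 + p.2).cluster o then 0 else 1 := ⟨_, fun _ => rfl⟩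
  have hF1 : ∀ p, F p ≤ 1 := fun p => by rw [hF]; split_ifs <;> simp
  have hloc : ∀ n₁ n₂ n₂' : Current (freeBoxGraph 3 n),
      (∀ e : (freeBoxGraph 3 n).edgeFinset,
        ¬ Current.EdgeOff ((n₁ + n₂).cluster o) (e : Sym2 (BoxVertex 3 n)) → n₂' e = n₂ e) →
      F (n₁, n₂') = F (n₁, n₂) := fun n₁ n₂ n₂' h => by
    simp only [hF, Current.cluster_add_congr_right h]
  have hvan : ∀ n₁ n₂ : Current (freeBoxGraph 3 n), n₁.sources = {o} ∆ {x} →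
      n₂.sources = {a} ∆ {b} → F (n₁, n₂) ≠ 0 → Disjoint ((n₁ + n₂).cluster o) ({a} ∆ {b}) := by
    intro n₁ n₂ _ _ hF0
    simp only [hF] at hF0
    have h : ¬ (a ∈ (n₁ + n₂).cluster o ∨ b ∈ (n₁ + n₂).cluster o) := fun h => hF0 (if_pos h)
    push Not at h
    exact Finset.disjoint_left.2 fun v hv hv' => by
      rcases Finset.mem_symmDiff.1 hv' with ⟨h', -⟩ | ⟨h', -⟩ <;> rw [Finset.mem_singleton.1 h'] at hv <;>
        [exact h.1 hv; exact h.2 hv]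
  -- LHS: the mean screening as a normalised current sum
  obtain ⟨Φ, hΦ⟩ : ∃ Φ : Current (freeBoxGraph 3 n) × Current (freeBoxGraph 3 n) → ℝ≥0∞, ∀ p, Φ p =
      epairWeight (fun _ : (freeBoxGraph 3 n).edgeFinset => criticalBeta 3) ({o} ∆ {x}) ∅ p *
        (F p * Current.offRatio (fun _ : (freeBoxGraph 3 n).edgeFinset => criticalBeta 3) ((p.1 + p.2).cluster o) ({a} ∆ {b})) /
      (ecurrentSum (fun _ : (freeBoxGraph 3 n).edgeFinset => criticalBeta 3) ({o} ∆ {x}) *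
        ecurrentSum (fun _ : (freeBoxGraph 3 n).edgeFinset => criticalBeta 3) ({a} ∆ {b})) := ⟨_, fun _ => rfl⟩
  have hL : meanScreening n n o x a b = (∑' p, Φ p).toReal := by
    have hfin : ∀ p, Φ p ≠ ∞ := fun p => by
      rw [hΦ]
      exact ENNReal.div_ne_top (ENNReal.mul_ne_top (epairWeight_ne_top _ _ _ p) (ENNReal.mul_ne_top
        (ne_top_of_le_ne_top ENNReal.one_ne_top (hF1 p)) (offRatio_ne_top hK _ _)))
        (mul_ne_zero (hZne _ hcA) (hZne _ hcB))
    show ∫ ω, screenWeight n n o a b ω ∂_ = _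
    rw [integral_sourcedDoubleCurrentLaw n hβ, ENNReal.tsum_toReal_eq hfin]
    simp only [hsA, hs0]
    refine tsum_congr fun p => ?_
    rw [pairWeight_div_eq_toReal _ hβ hcA hc0, screenWeight_sourcedTrace n ho ha hb p, ← hF p,
      ← ENNReal.toReal_mul, div_mul_mul_div_rearrange (hZtop _) (hZtop _) (hZne _ hc0) (hZtop _), hΦ]
  -- RHS: the avoidance probability as a normalised current sum
  have hR : (sourcedDoubleCurrentLaw 3 n (criticalBeta 3) ({(o : Site 3)} ∆ {(x : Site 3)})
        ({(a : Site 3)} ∆ {(b : Site 3)})).real (openConn (o : Site 3) (a : Site 3)) =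
      1 - ((∑' p, epairWeight (fun _ : (freeBoxGraph 3 n).edgeFinset => criticalBeta 3) ({o} ∆ {x}) ({a} ∆ {b}) p * F p) /
        (ecurrentSum (fun _ : (freeBoxGraph 3 n).edgeFinset => criticalBeta 3) ({o} ∆ {x}) *
          ecurrentSum (fun _ : (freeBoxGraph 3 n).edgeFinset => criticalBeta 3) ({a} ∆ {b}))).toReal := by
    haveI : IsProbabilityMeasure (doubleCurrentMeasure (freeBoxGraph 3 n) (criticalBeta 3) ({o} ∆ {x}) ({a} ∆ {b})) :=
      isProbabilityMeasure_doubleCurrentMeasure_holds _ hβ hcA hcB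
    rw [measureReal_def, sourcedDoubleCurrentLaw_apply n _ _ _
        (measurableSet_openConn_holds (o : Site 3) (a : Site 3)),
      sourcedTrace_preimage_openConn 3 o a, hsA, hsB, ← measureReal_def, ← sub_sub_cancel 1
        ((doubleCurrentMeasure (freeBoxGraph 3 n) (criticalBeta 3) ({o} ∆ {x}) ({a} ∆ {b})).real _),
      ← probReal_compl_eq_one_sub (measurableSet_tracedConn _ o a), measureReal_def,
      doubleCurrentMeasure_apply_eq_tsum_div _ hβ hcA hcB]
    congr 3
    refine tsum_congr fun p => ?_
    rw [epairWeight_mul_indicator_not_conn, hF]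
  -- assembly by Lemma A.1
  rw [hR, sub_sub_cancel, hL]
  simp only [hΦ, div_eq_mul_inv, ENNReal.tsum_mul_right]
  rw [Current.tsum_epairWeight_eq_tsum_mul_offRatio hK o ({o} ∆ {x}) ({a} ∆ {b}) F hloc hvan]

end Box

/-- **(C0) THE SCREENING DICTIONARY** (Aizenman–Duminil-Copin 2021, Lemma A.1 at the full radius, read on
the box trace laws): for `o, x, a, b ∈ Λ_n`,
`meanScreening n n o x a b = 1 - P^{{o}∆{x},{a}∆{b}}_{Λ_n,β_c}[o ↔ a]` — registered stub
`stub_screeningIdentity` of line `screening-form-lemma-a1`. [cite: AizenmanDuminilCopinAnnals2021, Appendix A, Lemma A.1] -/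
theorem stub_screeningIdentity : ScreeningIdentity := by
  intro n o x a b ho hx ha hb
  exact meanScreening_eq_one_sub n ⟨o, box_subset_box_succ 3 n ho⟩ ⟨x, box_subset_box_succ 3 n hx⟩
    ⟨a, box_subset_box_succ 3 n ha⟩ ⟨b, box_subset_box_succ 3 n hb⟩ ho hx ha hb

end Summit.CriticalPhenomena.Ising3DConformalLimit.EnergyNotSigmaSquaredGapForcesFarMerging

end
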